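import Mathlib
import Summits.HodgeConjecture.HodgeConjecture.Theorems.HodgeLocusCensusExSet632RrefG1

/-!
# (6,3,2) exceptional set in characteristic 0 — the point λ = ∞ of the rref pencil: rank R1 = 4 (lead gen 20, addendum to `ExSet632RrefG1`)

HONEST FRAMING: certified instances and evidence bearing on the general Hodge conjecture; no claim.

`HodgeLocusCensusExSet632RrefG1` re-derives g₁ = λ(λ−1) of ivhs-2's record M632-CHAR0-g22 from the five printed rref rows
[R0 | R1] of [B0 | B1] (B(λ) = B0 + λ·B1 the 8×7 presentation matrix of the first-order obstruction module at the rational cubic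
pencil C2), and pins the finite zero set of g₁ to {0, 1}; its docstring leaves the point λ = ∞ of the pencil — rank B1 = rank R1 —
to the exact computation.  This addendum closes that gap in the kernel, answering referee report R103(b) (which confirms rank R1 = 4
by an independent program):

* `R1_row0_eq`        : row 0 of R1 is the sum of rows 1, 2, 3;
* `maxMinor_R1_zero`  : hence EVERY maximal (5×5) minor of R1 vanishes (any column selection, repetitions allowed) — rank R1 ≤ 4,
                        i.e. rank B1 < 5: the point λ = ∞ belongs to the first-order exceptional set, as printed (E = {0, 1, ∞});
* `minor_R1_rows1234_cols0456` : the 4×4 minor of R1 on rows {1,2,3,4} and columns {0,4,5,6} equals 1 — rank R1 ≥ 4.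

So rank R1 = 4 exactly, over any field (the entries are 0, ±1).  Since B1 = P·R1 with P injective (the rref change of basis of
`ExSet632RrefG1`), rank B1 = 4 as well.  NOT FORMALISED (unchanged): the derivation of [B0 | B1] from the cubic C2, g₂, the passage
to μ₀, any Hodge theory.  Nothing here is a statement about the Hodge conjecture.
-/

namespace Summit.HodgeConjecture.HodgeConjecture.HodgeLocus.Census.ExSet632RrefG1

open Matrix

variable {K : Type*} [Field K]

/-- Row 0 of R1 is the sum of rows 1, 2 and 3. -/
theorem R1_row0_eq : (R1 : Matrix (Fin 5) (Fin 7) K) 0 = R1 1 + R1 2 + R1 3 := by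
  funext j
  fin_cases j <;> simp [R1]

/-- Every maximal minor of R1 vanishes (rank R1 ≤ 4): λ = ∞ is in the first-order exceptional set of the pencil. -/
theorem maxMinor_R1_zero (c : Fin 5 → Fin 7) : ((R1 : Matrix (Fin 5) (Fin 7) K).submatrix id c).det = 0 := by
  set N : Matrix (Fin 5) (Fin 5) K := (R1 : Matrix (Fin 5) (Fin 7) K).submatrix id c with hN
  have h0 : N 0 = N 1 + N 2 + N 3 := by
    funext j
    simp only [hN, Matrix.submatrix_apply, id_eq, Pi.add_apply]
    have := congrFun (R1_row0_eq (K := K)) (c j)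
    simpa [Pi.add_apply] using this
  by_contra hdet
  have li := Matrix.linearIndependent_rows_of_det_ne_zero hdet
  have hg : ∑ i : Fin 5, (![(1 : K), -1, -1, -1, 0] i) • N i = 0 := by
    simp only [Fin.sum_univ_five, Matrix.cons_val_zero, Matrix.cons_val_one, h0]
    ext j
    simp [Matrix.cons_val]
    ring
  have h := Fintype.linearIndependent_iff.mp li ![(1 : K), -1, -1, -1, 0] hg 0
  simp at h

/-- A non-zero 4×4 minor of R1: rows {1,2,3,4}, columns {0,4,5,6} (rank R1 ≥ 4). -/
theorem minor_R1_rows1234_cols0456 :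
    ((R1 : Matrix (Fin 5) (Fin 7) K).submatrix Fin.succ ![0, 4, 5, 6]).det = 1 := by
  simp [Matrix.det_succ_row_zero, Fin.sum_univ_succ, Matrix.submatrix, Fin.succAbove, R1]
  try norm_num
  try ring

end Summit.HodgeConjecture.HodgeConjecture.HodgeLocus.Census.ExSet632RrefG1
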